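import Summits.KontsevichZagierPeriods.KontsevichZagierPeriods.Theorems.SymplecticScissorsRealOnePeriodRelationsStubCells
import Literature.NumberTheory.Transcendental.KZSemiCanonicalReductionDimOne
import Mathlib.FieldTheory.AlgebraicClosure

/-!
# `RealOnePeriodRelations`, line `nash-retraction-thin-strip`, stub `stub_ratCells` — auxiliary file

The stub `stub_ratCells` of the crux `RealOnePeriodRelations` (stmt-KontsevichZagierPeriods-10042, route
`SymplecticScissors`, reshape 3: the unconditional rational layer) is the rational twin of `stub_cells`:
every element of the subgroup of `KZ.FormalRep` generated by the one-dimensional representations of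
Kontsevich–Zagier's literal shape (`KZ.IntegralRep.IsRational`) is, modulo
`M₁ = closure (1a ∪ 1b ∪ 2 ∪ Green)`, a `ℤ`-combination of *rational unit cells*: representations on
`{z | z 0 ∈ (0,1)}` whose integrand is on `(0,1)` a quotient `P/Q` of polynomials with real algebraic
coefficients (`algebraicClosure ℚ ℝ`), `Q ≠ 0` on `(0,1)`. This file supplies the bookkeeping and the
change of variables:

* `helper_ratCells_1` (registered anchor) — homogenisation `B^N · P(A/B) = Σ_{k ≤ N} P_k A^k B^{N-k}`;
* `RatCells.ratFns S` — the functions `ℝ → ℝ` agreeing on `S ⊆ ℝ` with such a quotient, denominator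
  non-vanishing on `S`; closed under restriction, algebraic constants, `+`, `−`, `×`, non-vanishing `⁻¹`,
  and COMPOSITION with a member mapping into `S` (by the homogenisation identity);
* `RatCells.cellSpanRat` — the elements of `KZ.FormalRep` which are, modulo `M₁`, `ℤ`-combinations of
  rational unit cells; an additive subgroup containing `M₁`, with the splitting lemma of rule (1a);
* `RatCells.exists_push`, `RatCells.of_mem_cellSpanRat_of_chart`, `RatCells.of_mem_cellSpanRat_Ioo`,
  `RatCells.of_mem_cellSpanRat_window` — rule (2) along a chart with rational derivative and rational
  inverse keeps rationality of the integrand (`helper_cells_1`); the affine chart of a bounded cell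
  with algebraic end points; the base case of the window induction of the main file.

References: M. Kontsevich, D. Zagier, *Periods* (2001), §1.1–§1.2; J. Bochnak, M. Coste, M.-F. Roy,
*Real Algebraic Geometry* (1998), §2.2.
-/

noncomputable section
open scoped BigOperators Polynomial
open Set MeasureTheory Filter Topology
open scoped ContDiff
open Literature.NumberTheory.Transcendental Literature.ModelTheory.ExponentialFields
open Summit.KontsevichZagierPeriods.SymplecticScissors.RealOnePeriodRelationsNegative (M₁ H₁)

namespace Summit.KontsevichZagierPeriods.SymplecticScissors.RealOnePeriodRelations

/-- **Homogenisation** (registered anchor `helper_ratCells_1`): for polynomials `P, A, B` with real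
algebraic coefficients, `deg P ≤ N` and `B(u) ≠ 0`,
`(Σ_{k ≤ N} P_k A^k B^{N-k}) (u) = P (A(u) / B(u)) · B(u)^N` — the identity which makes the composite of
two quotients of polynomials a quotient of polynomials (`RatCells.RatFn.comp`). [folklore] -/
theorem helper_ratCells_1 : ∀ (P A B : Polynomial (algebraicClosure ℚ ℝ)) (N : ℕ), P.natDegree ≤ N → ∀ (u : ℝ), Polynomial.aeval u B ≠ 0 → Polynomial.aeval u (∑ k ∈ Finset.range (N + 1), Polynomial.C (P.coeff k) * A ^ k * B ^ (N - k)) = Polynomial.aeval (Polynomial.aeval u A / Polynomial.aeval u B) P * Polynomial.aeval u B ^ N := by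
  intro P A B N hN u hB
  rw [Polynomial.aeval_eq_sum_range' (Nat.lt_succ_of_le hN), Finset.sum_mul, map_sum]
  refine Finset.sum_congr rfl fun k hk => ?_
  obtain ⟨m, hm⟩ := Nat.exists_eq_add_of_le (Nat.le_of_lt_succ (Finset.mem_range.mp hk))
  rw [hm, Nat.add_sub_cancel_left, map_mul, map_mul, map_pow, map_pow, Polynomial.aeval_C,
    Algebra.smul_def, pow_add, div_pow, mul_assoc, mul_assoc]
  congr 1
  field_simp

namespace RatCells

/-! ## Quotients of polynomials with real algebraic coefficients -/

/-- The functions `ℝ → ℝ` which agree on `S` with a quotient `P/Q` of polynomials with real algebraic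
coefficients whose denominator does not vanish on `S`. [cite: KontsevichZagier2001, §1.1] -/
def ratFns (S : Set ℝ) : Set (ℝ → ℝ) :=
  {f | ∃ P Q : Polynomial (algebraicClosure ℚ ℝ), (∀ t ∈ S, Polynomial.aeval t Q ≠ 0) ∧
    ∀ t ∈ S, f t = Polynomial.aeval t P / Polynomial.aeval t Q}

namespace RatFn

variable {S T : Set ℝ} {f g ψ : ℝ → ℝ}

/-- Restriction. [folklore] -/
theorem mono (h : f ∈ ratFns S) (hT : T ⊆ S) : f ∈ ratFns T := by
  obtain ⟨P, Q, hQ, hf⟩ := h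
  exact ⟨P, Q, fun t ht => hQ t (hT ht), fun t ht => hf t (hT ht)⟩

/-- Invariance under functions agreeing on `S`. [folklore] -/
theorem congr (h : f ∈ ratFns S) (hfg : ∀ t ∈ S, f t = g t) : g ∈ ratFns S := by
  obtain ⟨P, Q, hQ, hf⟩ := h
  exact ⟨P, Q, hQ, fun t ht => (hfg t ht).symm.trans (hf t ht)⟩

/-- A polynomial is such a quotient (denominator `1`). [folklore] -/
theorem poly (S : Set ℝ) (P : Polynomial (algebraicClosure ℚ ℝ)) :
    (fun t => Polynomial.aeval t P) ∈ ratFns S :=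
  ⟨P, 1, fun t _ => by simp, fun t _ => by simp⟩

/-- An algebraic constant. [folklore] -/
theorem const (S : Set ℝ) {a : ℝ} (ha : IsAlgebraic ℚ a) : (fun _ => a) ∈ ratFns S :=
  congr (poly S (Polynomial.C (⟨a, mem_algebraicClosure_iff.2 ha⟩ : algebraicClosure ℚ ℝ))) fun t _ => by
    rw [Polynomial.aeval_C, IntermediateField.algebraMap_apply]

/-- The identity. [folklore] -/
theorem id (S : Set ℝ) : (fun t => t) ∈ ratFns S :=
  congr (poly S (Polynomial.X : Polynomial (algebraicClosure ℚ ℝ))) fun t _ => by rw [Polynomial.aeval_X]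

/-- Sums. [folklore] -/
theorem add (hf : f ∈ ratFns S) (hg : g ∈ ratFns S) : (fun t => f t + g t) ∈ ratFns S := by
  obtain ⟨P, Q, hQ, hf⟩ := hf
  obtain ⟨P', Q', hQ', hg⟩ := hg
  refine ⟨P * Q' + Q * P', Q * Q', fun t ht => ?_, fun t ht => ?_⟩
  · rw [map_mul]; exact mul_ne_zero (hQ t ht) (hQ' t ht)
  · dsimp only
    rw [hf t ht, hg t ht, div_add_div _ _ (hQ t ht) (hQ' t ht)]
    simp only [map_mul, map_add]

/-- Negatives. [folklore] -/
theorem neg (hf : f ∈ ratFns S) : (fun t => -f t) ∈ ratFns S := by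
  obtain ⟨P, Q, hQ, hf⟩ := hf
  refine ⟨-P, Q, hQ, fun t ht => ?_⟩
  dsimp only
  rw [hf t ht, map_neg, neg_div]

/-- Differences. [folklore] -/
theorem sub (hf : f ∈ ratFns S) (hg : g ∈ ratFns S) : (fun t => f t - g t) ∈ ratFns S :=
  congr (add hf (neg hg)) fun _ _ => (sub_eq_add_neg _ _).symm

/-- Products. [folklore] -/
theorem mul (hf : f ∈ ratFns S) (hg : g ∈ ratFns S) : (fun t => f t * g t) ∈ ratFns S := by
  obtain ⟨P, Q, hQ, hf⟩ := hf
  obtain ⟨P', Q', hQ', hg⟩ := hg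
  refine ⟨P * P', Q * Q', fun t ht => ?_, fun t ht => ?_⟩
  · rw [map_mul]; exact mul_ne_zero (hQ t ht) (hQ' t ht)
  · dsimp only
    rw [hf t ht, hg t ht, div_mul_div_comm, map_mul, map_mul]

/-- Inverses of non-vanishing quotients. [folklore] -/
theorem inv (hf : f ∈ ratFns S) (hne : ∀ t ∈ S, f t ≠ 0) : (fun t => (f t)⁻¹) ∈ ratFns S := by
  obtain ⟨P, Q, hQ, hf⟩ := hf
  refine ⟨Q, P, fun t ht hP => hne t ht ?_, fun t ht => ?_⟩
  · rw [hf t ht, hP, zero_div]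
  · dsimp only
    rw [hf t ht, inv_div]

/-- Quotients with non-vanishing denominator. [folklore] -/
theorem div (hf : f ∈ ratFns S) (hg : g ∈ ratFns S) (hne : ∀ t ∈ S, g t ≠ 0) :
    (fun t => f t / g t) ∈ ratFns S :=
  congr (mul hf (inv hg hne)) fun _ _ => (div_eq_mul_inv _ _).symm

/-- Powers. [folklore] -/
theorem pow (hf : f ∈ ratFns S) (n : ℕ) : (fun t => f t ^ n) ∈ ratFns S := by
  induction n with
  | zero => exact congr (const S isAlgebraic_one) fun _ _ => (pow_zero _).symm
  | succ n ih => exact congr (mul ih hf) fun _ _ => (pow_succ _ _).symm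

/-- Composition: `f ∘ ψ` for `f` a quotient on `S`, `ψ` a quotient on `T` mapping `T` into `S`.
[folklore] -/
theorem comp (hf : f ∈ ratFns S) (hψ : ψ ∈ ratFns T) (hmaps : MapsTo ψ T S) :
    (fun u => f (ψ u)) ∈ ratFns T := by
  obtain ⟨P, Q, hQ, hf⟩ := hf
  obtain ⟨A, B, hB, hψ⟩ := hψ
  set N := max P.natDegree Q.natDegree
  refine ⟨∑ k ∈ Finset.range (N + 1), Polynomial.C (P.coeff k) * A ^ k * B ^ (N - k),
    ∑ k ∈ Finset.range (N + 1), Polynomial.C (Q.coeff k) * A ^ k * B ^ (N - k),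
    fun u hu => ?_, fun u hu => ?_⟩
  · rw [helper_ratCells_1 Q A B _ (le_max_right _ _) u (hB u hu), ← hψ u hu]
    exact mul_ne_zero (hQ _ (hmaps hu)) (pow_ne_zero _ (hB u hu))
  · dsimp only
    rw [helper_ratCells_1 P A B _ (le_max_left _ _) u (hB u hu),
      helper_ratCells_1 Q A B _ (le_max_right _ _) u (hB u hu), ← hψ u hu, hf _ (hmaps hu),
      mul_div_mul_right _ _ (pow_ne_zero _ (hB u hu))]

end RatFn

/-! ## One-dimensional domains read on `ℝ` -/

/-- A subset of `ℝ¹` read on `ℝ`. [folklore] -/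
def line (σ : Set (Fin 1 → ℝ)) : Set ℝ := {t | (fun _ : Fin 1 => t) ∈ σ}

/-- Membership in `line σ`. [folklore] -/
theorem mem_line {σ : Set (Fin 1 → ℝ)} {t : ℝ} : t ∈ line σ ↔ (fun _ : Fin 1 => t) ∈ σ := Iff.rfl

/-- A point of `ℝ¹` lies in `σ` iff its coordinate lies in `line σ`. [folklore] -/
theorem mem_iff_line (σ : Set (Fin 1 → ℝ)) (z : Fin 1 → ℝ) : z ∈ σ ↔ z 0 ∈ line σ := by
  rw [mem_line, ← KZ.eq_const_apply_zero z]

/-- `line` is monotone. [folklore] -/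
theorem line_mono {σ τ : Set (Fin 1 → ℝ)} (h : σ ⊆ τ) : line σ ⊆ line τ := fun _ ht => h ht

/-- `line` of a cell `{z | z 0 ∈ I}` is `I`. [folklore] -/
theorem line_setOf (I : Set ℝ) : line {z : Fin 1 → ℝ | z 0 ∈ I} = I := rfl

/-- A set in `ℝ¹` is the cell over its `line`. [folklore] -/
theorem eq_setOf_line (σ : Set (Fin 1 → ℝ)) : σ = {z | z 0 ∈ line σ} :=
  Set.ext fun z => mem_iff_line σ z

/-! ## `ℤ`-combinations of rational unit cells -/

/-- The elements of `FormalRep` which are, modulo `M₁`, `ℤ`-combinations of *rational unit cells*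
(representations on `{z | z 0 ∈ (0,1)}` whose integrand is on `(0,1)` a quotient of polynomials with
real algebraic coefficients, denominator non-vanishing on `(0,1)`): an additive subgroup.
[cite: KontsevichZagier2001, §1.2] -/
def cellSpanRat : AddSubgroup KZ.FormalRep where
  carrier := {c | ∃ N : KZ.IntegralRep 1 →₀ ℤ,
    (∀ ρ ∈ N.support, ρ.domain = {z | z 0 ∈ Set.Ioo (0 : ℝ) 1} ∧
      ∃ P Q : Polynomial (algebraicClosure ℚ ℝ),
        (∀ t ∈ Set.Ioo (0 : ℝ) 1, Polynomial.aeval t Q ≠ 0) ∧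
        ∀ t ∈ Set.Ioo (0 : ℝ) 1, ρ.integrand (fun _ => t) = Polynomial.aeval t P / Polynomial.aeval t Q) ∧
    c - N.sum (fun ρ m => m • KZ.of ρ) ∈ M₁}
  zero_mem' := ⟨0, by simp, by simp [M₁.zero_mem]⟩
  add_mem' := by
    classical
    rintro c c' ⟨N, hN, hcN⟩ ⟨N', hN', hcN'⟩
    refine ⟨N + N', fun ρ hρ => ?_, ?_⟩
    · rcases Finset.mem_union.mp (Finsupp.support_add hρ) with h | h
      · exact hN ρ h
      · exact hN' ρ h
    · rw [Cells.combo_add]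
      convert M₁.add_mem hcN hcN' using 1
      abel
  neg_mem' := by
    rintro c ⟨N, hN, hcN⟩
    refine ⟨-N, fun ρ hρ => hN ρ (by simpa [Finsupp.support_neg] using hρ), ?_⟩
    rw [Cells.combo_neg]
    convert M₁.neg_mem hcN using 1
    abel

/-- `M₁ ≤ cellSpanRat` (take `N = 0`). [folklore] -/
theorem mem_cellSpanRat_of_mem_M₁ {c : KZ.FormalRep} (hc : c ∈ M₁) : c ∈ cellSpanRat :=
  ⟨0, by simp, by simpa using hc⟩

/-- Transport along `M₁`: `c − c' ∈ M₁`, `c' ∈ cellSpanRat ⇒ c ∈ cellSpanRat`. [folklore] -/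
theorem mem_cellSpanRat_of_sub_mem {c c' : KZ.FormalRep} (hc' : c' ∈ cellSpanRat) (h : c - c' ∈ M₁) :
    c ∈ cellSpanRat := by
  have := cellSpanRat.add_mem (mem_cellSpanRat_of_mem_M₁ h) hc'
  rwa [sub_add_cancel] at this

/-- A rational unit cell lies in `cellSpanRat` (take `N = δ_ρ`). [folklore] -/
theorem of_mem_cellSpanRat_of_unitCell {ρ : KZ.IntegralRep 1}
    (hdom : ρ.domain = {z | z 0 ∈ Set.Ioo (0 : ℝ) 1})
    (hc : (fun t : ℝ => ρ.integrand (fun _ : Fin 1 => t)) ∈ ratFns (Set.Ioo (0 : ℝ) 1)) :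
    KZ.of ρ ∈ cellSpanRat := by
  classical
  refine ⟨Finsupp.single ρ 1, fun ρ' hρ' => ?_, ?_⟩
  · rw [Finsupp.support_single _ one_ne_zero, Finset.mem_singleton] at hρ'
    rw [hρ']
    exact ⟨hdom, hc⟩
  · rw [Cells.combo_single, sub_self]
    exact M₁.zero_mem

/-- A representation with null domain lies in `cellSpanRat`. [cite: KontsevichZagier2001, §1.2 rule (1)] -/
theorem of_mem_cellSpanRat_of_null (r : KZ.IntegralRep 1) (h : volume r.domain = 0) :
    KZ.of r ∈ cellSpanRat :=
  mem_cellSpanRat_of_mem_M₁ (HomotopyInvariance.of_mem_of_volume_zero r h)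

/-- **Splitting off a semialgebraic piece and its complement** (rule 1a): `[r] ∈ cellSpanRat` as soon
as the restrictions of `r` to `r.domain ∩ t` and `r.domain ∩ tᶜ` are.
[cite: KontsevichZagier2001, §1.2 rule (1)] -/
theorem of_mem_cellSpanRat_of_split_compl (r : KZ.IntegralRep 1) (t : Set (Fin 1 → ℝ))
    (ht : IsSemialgebraic ℚ t)
    (hc₁ : KZ.of (r.restrict (r.domain ∩ t) (r.isSemialgebraic_domain.inter ht) inter_subset_left) ∈
      cellSpanRat)
    (hc₂ : KZ.of (r.restrict (r.domain ∩ tᶜ) (r.isSemialgebraic_domain.inter ht.compl)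
      inter_subset_left) ∈ cellSpanRat) : KZ.of r ∈ cellSpanRat := by
  refine mem_cellSpanRat_of_sub_mem (cellSpanRat.add_mem hc₁ hc₂) ?_
  rw [← sub_sub]
  refine HomotopyInvariance.of_sub_sub_mem_of_cover r _ _ inter_subset_left inter_subset_left
    (fun _ _ => rfl) (fun _ _ => rfl) ?_ ?_
  · rw [KZ.IntegralRep.domain_restrict, KZ.IntegralRep.domain_restrict,
      show r.domain ∩ t ∩ (r.domain ∩ tᶜ) = ∅ by
        ext z; simp only [mem_inter_iff, mem_compl_iff, mem_empty_iff_false, iff_false]; tauto]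
    exact measure_empty
  · rw [KZ.IntegralRep.domain_restrict, KZ.IntegralRep.domain_restrict, Set.inter_union_compl,
      Set.sdiff_self]
    exact measure_empty

/-! ## Change of variables preserving rationality -/

/-- **Rule (2) keeps rationality.** Push `r` forward along a chart `φ` (semialgebraic, with
semialgebraic positive derivative `φ'` and left inverse `ψ` on the domain): if the integrand and `φ'`
are quotients of polynomials on the domain and `ψ` is one on its image, then the push-forward `s`
(`[r] − [s] ∈ M₁`) has domain the image and integrand the quotient `u ↦ r.integrand (ψ u) / φ' (ψ u)`.
[cite: KontsevichZagier2001, §1.2 rule (2)] -/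
theorem exists_push (r : KZ.IntegralRep 1) (φ φ' ψ : ℝ → ℝ)
    (hφ : IsSemialgebraicFunOn ℚ r.domain (fun p => φ (p 0)))
    (hφ' : IsSemialgebraicFunOn ℚ r.domain (fun p => φ' (p 0)))
    (hder : ∀ t ∈ line r.domain, HasDerivAt φ (φ' t) t) (hpos : ∀ t ∈ line r.domain, 0 < φ' t)
    (hψφ : ∀ t ∈ line r.domain, ψ (φ t) = t)
    (hf : (fun t => r.integrand (fun _ => t)) ∈ ratFns (line r.domain))
    (hφ'r : φ' ∈ ratFns (line r.domain)) (hψr : ψ ∈ ratFns (φ '' line r.domain)) :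
    ∃ s : KZ.IntegralRep 1, line s.domain = φ '' line r.domain ∧
      (fun u => s.integrand (fun _ => u)) ∈ ratFns (line s.domain) ∧ KZ.of r - KZ.of s ∈ M₁ := by
  have hmem' : ∀ p : Fin 1 → ℝ, p ∈ r.domain → p 0 ∈ line r.domain :=
    fun p hp => (mem_iff_line _ p).mp hp
  have hinj : InjOn (fun p : Fin 1 → ℝ => fun _ : Fin 1 => φ (p 0)) r.domain := by
    intro p hp p' hp' h
    have h0 : φ (p 0) = φ (p' 0) := congrFun h 0
    have : p 0 = p' 0 := by rw [← hψφ _ (hmem' p hp), ← hψφ _ (hmem' p' hp'), h0]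
    rw [KZ.eq_const_apply_zero p, KZ.eq_const_apply_zero p', this]
  obtain ⟨s, hsdom, hsi, hrel⟩ := helper_cells_1 r φ φ' hφ hφ' (fun p hp => hder _ (hmem' p hp))
    (fun p hp => (hpos _ (hmem' p hp)).ne') hinj
  have hline : line s.domain = φ '' line r.domain := by
    ext u
    rw [mem_line, hsdom]
    constructor
    · rintro ⟨p, hp, hpu⟩
      exact ⟨p 0, hmem' p hp, congrFun hpu 0⟩
    · rintro ⟨t, ht, rfl⟩
      exact ⟨fun _ => t, ht, rfl⟩
  have hmaps : MapsTo ψ (φ '' line r.domain) (line r.domain) := by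
    rintro _ ⟨t, ht, rfl⟩
    rw [hψφ t ht]
    exact ht
  refine ⟨s, hline, ?_, hrel⟩
  rw [hline]
  refine RatFn.congr (RatFn.div (RatFn.comp hf hψr hmaps) (RatFn.comp hφ'r hψr hmaps) ?_) ?_
  · rintro _ ⟨t, ht, rfl⟩
    rw [hψφ t ht]
    exact (hpos t ht).ne'
  · rintro _ ⟨t, ht, rfl⟩
    have h := hsi (fun _ => t) ht
    rw [hψφ t ht, h, abs_of_pos (hpos t ht)]

/-- A representation on a cell `{z | z 0 ∈ I}` with rational integrand, charted onto `(0,1)` by a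
semialgebraic bijection `φ : I → (0,1)` with positive rational derivative and rational inverse `ψ`, is
a rational unit cell modulo `M₁`. [cite: KontsevichZagier2001, §1.2 rule (2)] -/
theorem of_mem_cellSpanRat_of_chart (r : KZ.IntegralRep 1) (I : Set ℝ)
    (hdom : r.domain = {z | z 0 ∈ I}) (φ φ' ψ : ℝ → ℝ)
    (hφ : IsSemialgebraicFunOn ℚ r.domain (fun p => φ (p 0)))
    (hφ' : IsSemialgebraicFunOn ℚ r.domain (fun p => φ' (p 0)))
    (hder : ∀ t ∈ I, HasDerivAt φ (φ' t) t) (hpos : ∀ t ∈ I, 0 < φ' t)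
    (hmaps : MapsTo φ I (Ioo 0 1)) (hψmaps : MapsTo ψ (Ioo 0 1) I)
    (hψφ : ∀ t ∈ I, ψ (φ t) = t) (hφψ : ∀ u ∈ Ioo (0 : ℝ) 1, φ (ψ u) = u)
    (hf : (fun t => r.integrand (fun _ => t)) ∈ ratFns I) (hφ'r : φ' ∈ ratFns I)
    (hψr : ψ ∈ ratFns (Ioo (0 : ℝ) 1)) : KZ.of r ∈ cellSpanRat := by
  have hI : line r.domain = I := by rw [hdom, line_setOf]
  have himg : φ '' I = Ioo 0 1 := by
    refine (hmaps.image_subset).antisymm fun u hu => ?_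
    exact ⟨ψ u, hψmaps hu, hφψ u hu⟩
  rw [← hI] at hder hpos hψφ hf hφ'r himg
  rw [← himg] at hψr
  obtain ⟨s, hs, hsrat, hrel⟩ := exists_push r φ φ' ψ hφ hφ' hder hpos hψφ hf hφ'r hψr
  rw [himg] at hs
  refine mem_cellSpanRat_of_sub_mem (of_mem_cellSpanRat_of_unitCell ?_ ?_) hrel
  · rw [eq_setOf_line s.domain, hs]
  · rw [← hs]
    exact hsrat

/-- **A bounded open cell** `{z | z 0 ∈ (a, b)}` with algebraic end points and rational integrand is a
rational unit cell modulo `M₁`: the affine chart `t ↦ (t − a)/(b − a)` has algebraic coefficients.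
[cite: KontsevichZagier2001, §1.2 rule (2)] -/
theorem of_mem_cellSpanRat_Ioo (r : KZ.IntegralRep 1) {a b : ℝ} (hab : a < b) (ha : IsAlgebraic ℚ a)
    (hb : IsAlgebraic ℚ b) (hdom : r.domain = {z | z 0 ∈ Ioo a b})
    (hf : (fun t => r.integrand (fun _ => t)) ∈ ratFns (Ioo a b)) : KZ.of r ∈ cellSpanRat := by
  have hσ := r.isSemialgebraic_domain
  have hba : b - a ≠ 0 := (sub_pos.mpr hab).ne'
  have hk : 0 < (b - a)⁻¹ := inv_pos.mpr (sub_pos.mpr hab)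
  have hkalg : IsAlgebraic ℚ (b - a)⁻¹ := (hb.sub ha).inv
  refine of_mem_cellSpanRat_of_chart r (Ioo a b) hdom (fun t => (t - a) * (b - a)⁻¹)
    (fun _ => (b - a)⁻¹) (fun u => a + (b - a) * u) ?_ ?_ ?_ (fun _ _ => hk) ?_ ?_ ?_ ?_ hf
    (RatFn.const _ hkalg) (RatFn.add (RatFn.const _ ha) (RatFn.mul (RatFn.const _ (hb.sub ha)) (RatFn.id _)))
  · exact ((isSemialgebraicFunOn_apply hσ 0).fun_sub
      (isSemialgebraicFunOn_const_of_isAlgebraic hσ ha)).fun_mul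
      (isSemialgebraicFunOn_const_of_isAlgebraic hσ hkalg)
  · exact isSemialgebraicFunOn_const_of_isAlgebraic hσ hkalg
  · intro t _
    simpa using ((hasDerivAt_id t).sub_const a).mul_const (b - a)⁻¹
  · intro t ht
    dsimp only
    rw [← div_eq_mul_inv]
    exact ⟨div_pos (sub_pos.mpr ht.1) (sub_pos.mpr hab),
      (div_lt_one (sub_pos.mpr hab)).mpr (by linarith [ht.2])⟩
  · intro u hu
    constructor <;> nlinarith [hu.1, hu.2, sub_pos.mpr hab]
  · intro t _
    field_simp
    ring
  · intro u _
    field_simp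
    ring

/-- **Base case of the window induction**: a representation inside a window `(a, b)` with algebraic
end points which fills the window (with rational integrand) or misses it lies in `cellSpanRat`.
[cite: KontsevichZagier2001, §1.2] -/
theorem of_mem_cellSpanRat_window (r : KZ.IntegralRep 1) {a b : ℝ} (ha : IsAlgebraic ℚ a)
    (hb : IsAlgebraic ℚ b) (hdom : r.domain ⊆ {z | z 0 ∈ Ioo a b})
    (H1 : {z : Fin 1 → ℝ | z 0 ∈ Ioo a b} ⊆ r.domain ∨ Disjoint {z : Fin 1 → ℝ | z 0 ∈ Ioo a b} r.domain)
    (H2 : {z : Fin 1 → ℝ | z 0 ∈ Ioo a b} ⊆ r.domain →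
      (fun t => r.integrand (fun _ => t)) ∈ ratFns (Ioo a b)) : KZ.of r ∈ cellSpanRat := by
  rcases H1 with h | h
  · rcases lt_or_ge a b with hab | hab
    · exact of_mem_cellSpanRat_Ioo r hab ha hb (hdom.antisymm h) (H2 h)
    · refine of_mem_cellSpanRat_of_null r (measure_mono_null hdom ?_)
      rw [Ioo_eq_empty (not_lt.mpr hab)]
      simp
  · refine of_mem_cellSpanRat_of_null r ?_
    rw [h.symm.eq_bot_of_le hdom]
    exact measure_empty

end RatCells

end Summit.KontsevichZagierPeriods.SymplecticScissors.RealOnePeriodRelations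

end
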